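import Summits.Ventures.CertifiedManyBodySolver.Downfold.EmeryThermalBandSeam
import Summits.Ventures.CertifiedManyBodySolver.Downfold.EmeryBoxesNCCOK26FloorWord
import HarnessLib

/-!
# `T > 0` CAP WORDS (hypothesis-free) on Nd1.85Ce0.15CuO4 (M20) [#55 x0.10 / #56 Nd2CuO4 x0 share the one-body rows] — U-SLICE «(K) — `emeryBoxNCCOK26` (router/EMERY-FLOOR-ORDERS row 53; COVERAGE BATCH 3)

Venture CertifiedManyBodySolver, cell `pub/hubbard-downfold` (S1 = ROUTER) × crew hubbard-fast S2 (ii) × (iv) «T > 0 × multi-band»; seat hubbard-downfold-mod-4 (S1/S2 Emery seam).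
Namespace `Summit.Ventures.CertifiedManyBodySolver.Downfold`. PATTERN OF `EmeryThermalCapFromFloorSeam` / `EmeryThermalBandSeam`: the floor word `EmeryBoxesNCCOK26FloorWord` proves the four
tilted CuO₄ certificates `nCCOK26Floor_hq_lowerCorner` (device hubbard-box-p2 kgp1x5 chain, run for batch 3 by this seat, kit j316623); through hubbard-box-p1's R153 they are four
exact-tilt corner CAPS on the cell pressure (§1; tilts μ = (-8, -9, -43/5, -19/2), q₀ = (-2654597/40000, -6279593/80000, -1467193/20000, -3377403/40000), slopes −q₀/2 = (33.1825, 39.2475, 36.6798, 42.2175) eV/CuO₂);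
by monotone level transfer and convexity they bind the box at εp = -8: **`emeryBoxNCCOK26_pressureCap_m8`** `P_cell ≤ 6 log 2 + 42.2175375·β` (§2) and interpolate on the
`t_pd × t_pp` face (§3, face-centre slope 37.8318). No Rayleigh family exists for this object yet, so no floor / window at T > 0 is stated (the T = 0 floor word is).

Everything PROVED (0 sorry); no definition. HONEST FRAMING: certified inequalities on a SCREENING/EXTRAPOLATED object (U-slice / companion per EMERY-LINE); full entropy
`6 log 2` kept; grand-canonical at the stated level; no phase word; no router number moves.
-/

noncomputable section

namespace Summit.Ventures.CertifiedManyBodySolver.Downfold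

open NonemptyInterval Matrix Finset Literature.Probability.LatticeModels
open Literature.MathematicalPhysics.QuantumLattice Literature.Computation.Certificates
open Summit.Ventures.CertifiedManyBodySolver.Certificates OccupationCode ClusterLowerBound
open scoped BigOperators ComplexOrder

/-! ## §1 Tilts, slopes, exact-tilt corner caps -/

/-- Every tilt is at most the common level `-8` (tilts `(-8, -9, -43/5, -19/2)`). [folklore] -/
theorem nCCOK26Floor_mu_le_m8 (i : Fin 4) : nCCOK26Floor_mu i ≤ ((-8 : ℚ) : ℝ) := by
  fin_cases i <;> simp [nCCOK26Floor_mu] <;> norm_num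

/-- Every corner cap slope `−q₀ᵢ/2` is at most `3377403/80000` = 42.2175375 (corner 3); slopes `(33.1825, 39.2475, 36.6798, 42.2175)` eV per CuO₂ per unit β. [folklore] -/
theorem nCCOK26Floor_capSlope_le (i : Fin 4) : -nCCOK26Floor_q0 i / 2 ≤ (3377403/80000 : ℝ) := by
  fin_cases i <;> simp [nCCOK26Floor_q0] <;> norm_num

/-- **EXACT-TILT CORNER CAPS** (hypothesis-free, every β ≥ 0): `P_cell(β, emeryLine cuprateSigns (nCCOK26Corner i) + μᵢ·levelDir) ≤ 6 log 2 + β·(−q₀ᵢ/2)` — the floor word's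
certificate `nCCOK26Floor_hq_lowerCorner i` through hubbard-box-p1's `emeryCellPressure_le_of_cuO4Certificate`. [cite: Israel1979, Thm. I.2.4] [cite: ValentiStolzeHirschfeld1991, §II] -/
theorem emeryBoxNCCOK26_corner_pressureCap {β : ℝ} (hβ : 0 ≤ β) (i : Fin 4) :
    emeryCellPressure β (emeryLine cuprateSigns (nCCOK26Corner i) + nCCOK26Floor_mu i • levelDir) ≤ 6 * Real.log 2 + β * (-nCCOK26Floor_q0 i / 2) := by
  have h := emeryCellPressure_tiltedCorner_le_of_cuO4Certificate hβ (emeryLine cuprateSigns (nCCOK26Corner i)) (nCCOK26Floor_mu i) (M := 2) two_pos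
    (G := (fun _ : Fin 4 => (0 : FermionOp emeryCuO4Window)) i) (fun ω' _ => re_expect_zero_cuO4 ω') (q₀ := nCCOK26Floor_q0 i)
    (by rw [← nCCOK26_lowerCorner]; simpa using nCCOK26Floor_hq_lowerCorner i)
  simpa using h

/-! ## §2 The box cap word at the common level `εp = -8` (= max μᵢ; chemical potential 8 eV) -/

/-- **THE THERMAL CAP WORD (hypothesis-free)** on `emeryBoxNCCOK26`, cuprate signs, level `εp = -8`, EVERY β ≥ 0, EVERY point of the box:
`P_cell ≤ 6 log 2 + β·3377403/80000` (42.2175·β + 4.1589). [cite: Israel1979, Thm. I.2.4] [cite: ValentiStolzeHirschfeld1991, §II] -/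
theorem emeryBoxNCCOK26_pressureCap_m8 {β : ℝ} (hβ : 0 ≤ β) :
    HoldsOn (fun p : EmeryCoord → ℝ => emeryCellPressure β (emeryLine cuprateSigns (emeryLineCoords (((-8 : ℚ)) : ℝ) p)) ≤ 6 * Real.log 2 + β * (3377403/80000)) emeryBoxNCCOK26 :=
  holdsOn_emeryCellPressureCap_of_tiltedCuO4Certificates (E := emeryBoxNCCOK26) (eA := nccoK26Emery_tpd) (eB := nccoK26Emery_tpp) (eD := nccoK26Emery_Delta) (eUd := nccoK26Emery_Udd) (eUp := nccoK26Emery_Upp) (by simp [emeryBoxNCCOK26, emeryBoxNCCOK26Src, Function.update]) (by simp [emeryBoxNCCOK26, emeryBoxNCCOK26Src, Function.update]) (Function.update_self _ _ _) (by simp [emeryBoxNCCOK26, emeryBoxNCCOK26Src, Function.update]) (by simp [emeryBoxNCCOK26, emeryBoxNCCOK26Src, Function.update]) cuprateSigns hβ (M := 2) two_pos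
    (fun _ => 0) (fun _ ω' _ => re_expect_zero_cuO4 ω') nCCOK26Floor_mu nCCOK26Floor_q0 nCCOK26Floor_hq_lowerCorner nCCOK26Floor_mu_le_m8
    (fun i => by have h := nCCOK26Floor_capSlope_le i; simpa [div_eq_mul_inv] using h)

/-- **Grand-potential reading**: at chemical potential 8 eV, every `T > 0`, every point: `Ω/CuO₂ = −P_cell/β ≥ −3377403/80000 − 6 log 2/β` eV. [cite: Israel1979, Thm. I.2.4] -/
theorem emeryBoxNCCOK26_grandPotential_ge_m8 {β : ℝ} (hβ : 0 < β) :
    HoldsOn (fun p : EmeryCoord → ℝ => -(3377403/80000 : ℝ) - 6 * Real.log 2 / β ≤ -emeryCellPressure β (emeryLine cuprateSigns (emeryLineCoords (((-8 : ℚ)) : ℝ) p)) / β) emeryBoxNCCOK26 :=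
  holdsOn_grandPotential_ge_of_pressureCap cuprateSigns hβ _ (emeryBoxNCCOK26_pressureCap_m8 hβ.le)

/-! ## §3 The bilinear (function-valued) cap on the `t_pd × t_pp` face -/

/-- **BILINEAR THERMAL CAP (hypothesis-free)**, level `εp = -8`, EVERY β ≥ 0, EVERY point (face `t_pd ∈ [9/10, 129/100]`, `t_pp ∈ [13/25, 18/25]`; face-centre slope
37.8318 vs the constant word's 42.2175): `P_cell(β, θ(p)) ≤ Σᵢ wᵢ(t_pd, t_pp)·(6 log 2 + β·(−q₀ᵢ/2))`. [cite: Israel1979, Thm. I.3.4] [cite: ValentiStolzeHirschfeld1991, §II] -/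
theorem emeryBoxNCCOK26_pressureBilinearCap_m8 {β : ℝ} (hβ : 0 ≤ β) :
    HoldsOn (fun p : EmeryCoord → ℝ => emeryCellPressure β (emeryLine cuprateSigns (emeryLineCoords (((-8 : ℚ)) : ℝ) p)) ≤
      (((129/100 : ℝ) - p .tpd) * ((18/25 : ℝ) - p .tpp) * (6 * Real.log 2 + β * (2654597/80000)) +
        (p .tpd - (9/10 : ℝ)) * ((18/25 : ℝ) - p .tpp) * (6 * Real.log 2 + β * (6279593/160000)) +
        ((129/100 : ℝ) - p .tpd) * (p .tpp - (13/25 : ℝ)) * (6 * Real.log 2 + β * (1467193/40000)) +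
        (p .tpd - (9/10 : ℝ)) * (p .tpp - (13/25 : ℝ)) * (6 * Real.log 2 + β * (3377403/80000))) / (39/500 : ℝ)) emeryBoxNCCOK26 := by
  have h := holdsOn_emeryCellPressureBilinearCap_of_tiltedCuO4Certificates (E := emeryBoxNCCOK26) (eA := nccoK26Emery_tpd) (eB := nccoK26Emery_tpp) (eD := nccoK26Emery_Delta) (eUd := nccoK26Emery_Udd) (eUp := nccoK26Emery_Upp) (by simp [emeryBoxNCCOK26, emeryBoxNCCOK26Src, Function.update]) (by simp [emeryBoxNCCOK26, emeryBoxNCCOK26Src, Function.update]) (Function.update_self _ _ _) (by simp [emeryBoxNCCOK26, emeryBoxNCCOK26Src, Function.update]) (by simp [emeryBoxNCCOK26, emeryBoxNCCOK26Src, Function.update])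
    (by rw [nccoK26Emery_tpd, Entry.encl_ofEnds_fst, Entry.encl_ofEnds_snd]; norm_num)
    (by rw [nccoK26Emery_tpp, Entry.encl_ofEnds_fst, Entry.encl_ofEnds_snd]; norm_num)
    cuprateSigns hβ (M := 2) two_pos (fun _ => 0) (fun _ ω' _ => re_expect_zero_cuO4 ω') nCCOK26Floor_mu nCCOK26Floor_q0 nCCOK26Floor_hq_lowerCorner
    (εp := -8) nCCOK26Floor_mu_le_m8
  intro p hp
  have h' := h p hp
  simp only [nccoK26Emery_tpd, nccoK26Emery_tpp, Entry.encl_ofEnds_fst, Entry.encl_ofEnds_snd, nCCOK26Floor_q0,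
    Matrix.cons_val_zero, Matrix.cons_val_one, Matrix.cons_val_two, Matrix.cons_val, Matrix.head_cons, Matrix.tail_cons] at h'
  refine h'.trans (le_of_eq ?_)
  push_cast
  ring

end Summit.Ventures.CertifiedManyBodySolver.Downfold

end
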